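/-
Copyright (c) 2026. All rights reserved.
Released under Apache 2.0 license as described in the file LICENSE.
Authors: HodgeCM publication cell (pub-hodgecm), GR lane, seat GR-2 (`pub-hodgecm-own-hyp34`).
-/
import Literature.NumberTheory.GelbartRogawski1991.Prop311PrintedDarbouxLegsOfLeg
import Literature.NumberTheory.GelbartRogawski1991.Prop311AdelicCoordinates
import Literature.RepresentationTheory.HeisenbergGroup.HeisenbergCoboundary
import HarnessLib

-- build-lane note (ops-buildfix G11b-3 recipe): dependent telescopes of the CM dual-pair datum; elaborate sequentially.
set_option Elab.async false

/-!
# [GelbartRogawski1991, Prop. 3.1.1] AS PRINTED: print's `Mp_𝐀(W)` from the pairs of the coordinate model, along a Darboux frame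

Topic `NumberTheory/GelbartRogawski1991`; namespace `Literature.NumberTheory.GelbartRogawski1991.Prop311`.  KERNEL ONLY:
definitions with bodies (`toCoordHeisenberg`, `ofCoordSp`, `legOfFrameProd`, `legOfFrame`) and proved theorems; nothing of [GelbartRogawski1991] or
[Weil1964] is asserted; `Prop311AsPrinted` is untouched.

The frame files reduce the printed proposition at CM data to ONE continuous homomorphism
`φ₀ : Mp_ψ(𝐀ⁿ × 𝐀ⁿ, std)ᶜᵒⁿᵗ →* Mp_𝐀(W)` over ONE adelic Darboux frame `e : 𝐀ⁿ × 𝐀ⁿ ≃ W_𝐀`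
(`Prop311PrintedDarbouxLegsOfLeg.prop311_CM_of_darbouxLeg`).  A model `ρ` of print's `ρ_ψ` on a Hilbert space `S` that is
read off a representation `ρ₁` of the COORDINATE Heisenberg group `H(𝐀ⁿ × 𝐀ⁿ, std) = Weil1964.AdelicHeisenberg F (Fin n) 1`
through the frame — `ρ(h) = ρ₁(toCoordHeisenberg e h)`, `toCoordHeisenberg e (w, t) = (e⁻¹ w, t + ½ x·y)` (the `L²(𝐀_Fⁿ)` model is of this
shape) — receives such a `φ₀` from any homomorphism `ψ : Mp_ψ(𝐀ⁿ × 𝐀ⁿ, std)ᶜᵒⁿᵗ →* MpPsi ρ₁` over the identity of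
`Sp(𝐀ⁿ × 𝐀ⁿ, std)` with bounded operators (e.g. `Weil1964.adelicMpCont.unitaryLeg`): transport the symplectic component
along the frame and KEEP the operator.

* §1 `toCoordHeisenberg e he : H_𝐀(W) →* H(𝐀ⁿ × 𝐀ⁿ, std)` (Darboux coordinates followed by the coboundary `t ↦ t + ½ x·y`,
  `halfAltPolarEquiv ∘ Heisenberg.map e⁻¹`; bijective, identity on the centre) and `ofCoordSp e he : Sp(𝐀ⁿ × 𝐀ⁿ, std) →* Sp_𝐀(W)`
  (`g₁ ↦ e g₁ e⁻¹`); **`toCoordHeisenberg_act`**: `toCoordHeisenberg (g · h) = g₁ · toCoordHeisenberg h` for `g = e g₁ e⁻¹` (Weil's actions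
  `ofSymplectic` on both sides).
* §2 **`legOfFrame`**: for `ρ(h) f = ρ₁(toCoordHeisenberg e h) f` and `ψ : G →* MpPsi ρ₁` with bounded operators,
  `g ↦ (e π(ψ g) e⁻¹, M_{ψ g})` is a homomorphism `G →* Mp_𝐀(W)` (print's group of BOUNDED pairs, rendering R4); over
  `Mp_ψ(𝐀ⁿ × 𝐀ⁿ, std)ᶜᵒⁿᵗ` and `ψ` over the identity it lies over the frame: `π(legOfFrame m) (e c) = e (π₁(m) c)`.
* §3 continuity for print's topology R2: `continuous_legOfFrame_comp` — along any `t : Z → G`, continuity of the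
  `Sp`-orbit maps and of the operator orbit maps `z ↦ M_{ψ(t z)} f` gives continuity of `z ↦ legOfFrame (t z)`; on
  `Mp_ψ(𝐀ⁿ × 𝐀ⁿ, std)ᶜᵒⁿᵗ` the `Sp`-orbit maps are continuous for free (`continuous_legOfFrame_of_continuous_op`).
* §4 **`darbouxLegs_of_boundedLeg`** and the CM capstone **`prop311_CM_of_boundedLeg`**: such a `ψ` with strongly
  continuous operators gives `DarbouxLegs`, hence — at CM data — "`π` splits uniquely over `Sp_F(W)`" and clauses (1) ∧ (2)
  of Prop. 3.1.1 verbatim for the model `ρ`.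

## References
* [GelbartRogawski1991] S. Gelbart, J. Rogawski, Invent. Math. 105 (1991) 445–472, §3.1 p. 454 L17–36, Prop. 3.1.1
  p. 455 L1–2.
* [Weil1964] A. Weil, Acta Math. 111 (1964) 143–211, Chap. I n° 3–5, Chap. III n° 37–39.
* [MoeglinVignerasWaldspurger1987] C. Mœglin, M.-F. Vignéras, J.-L. Waldspurger, LNM 1291 (1987), Chap. 2 I.1, II.1.
-/

set_option autoImplicit false

noncomputable section

open NumberField
open scoped TensorProduct Matrix
open Literature.NumberTheory.Automorphic
open Literature.RepresentationTheory.HeisenbergGroup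
open Literature.NumberTheory.Weil1964

namespace Literature.NumberTheory.GelbartRogawski1991

namespace Prop311

/-! ## §1. The frame on the Heisenberg groups and on the symplectic groups -/

section Frame

variable {F : Type} [Field F] [NumberField F]
variable {E : Type} [Field E] [Algebra F E]
variable {V : Type} [AddCommGroup V] [Module F V]
variable {Φ : V →ₗ[F] V →ₗ[F] E}
variable {n : ℕ}
  (e : ((Fin n → AdeleRing (𝓞 F) F) × (Fin n → AdeleRing (𝓞 F) F)) ≃ₗ[AdeleRing (𝓞 F) F] AdelicSpace F V)
  (he : ∀ c c' : (Fin n → AdeleRing (𝓞 F) F) × (Fin n → AdeleRing (𝓞 F) F),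
    adelicTraceForm F E V Φ (e c) (e c') = c.1 ⬝ᵥ c'.2 - c'.1 ⬝ᵥ c.2)

include he in
/-- the Heisenberg law of `H_𝐀(W)` in Darboux coordinates is `½` the standard alternating form of the pairing `x · y`:
`heisForm (e c) (e c') = (½ altPolar std) c c'`. [cite: GelbartRogawski1991, §3.1 p. 454 L17–19] -/
theorem heisForm_frame (c c' : (Fin n → AdeleRing (𝓞 F) F) × (Fin n → AdeleRing (𝓞 F) F)) :
    heisForm F E V Φ (e c) (e c') =
      ((⅟(2 : AdeleRing (𝓞 F) F)) • altPolar (adelicForm F (Fin n) (1 : Matrix (Fin n) (Fin n) (AdeleRing (𝓞 F) F))))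
        c c' := by
  rw [heisForm_coord he, LinearMap.smul_apply, LinearMap.smul_apply, altPolar_apply, adelicForm_one_apply,
    adelicForm_one_apply, smul_eq_mul]

include he in
/-- `heisForm` is alternating (a Darboux frame exists). [cite: GelbartRogawski1991, §3.1 p. 454 L17–19] -/
theorem heisForm_self_eq_zero (w : AdelicSpace F V) : heisForm F E V Φ w w = 0 := by
  rw [← e.apply_symm_apply w, heisForm_frame e he, LinearMap.smul_apply, LinearMap.smul_apply, altPolar_self, smul_zero]

include he in
/-- the compatibility of `e⁻¹` with the two Heisenberg laws (hypothesis of `Heisenberg.map`).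
[cite: GelbartRogawski1991, §3.1 p. 454 L17–19] -/
theorem frame_map_compat (v w : AdelicSpace F V) :
    ((⅟(2 : AdeleRing (𝓞 F) F)) • altPolar (adelicForm F (Fin n) (1 : Matrix (Fin n) (Fin n) (AdeleRing (𝓞 F) F))))
        (e.symm.toLinearMap.toAddMonoidHom v) (e.symm.toLinearMap.toAddMonoidHom w) =
      (AddMonoidHom.id (AdeleRing (𝓞 F) F)) (heisForm F E V Φ v w) := by
  rw [AddMonoidHom.id_apply, LinearMap.toAddMonoidHom_coe, LinearEquiv.coe_coe, ← heisForm_frame e he,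
    LinearEquiv.apply_symm_apply, LinearEquiv.apply_symm_apply]

/-- **`toCoordHeisenberg e : H_𝐀(W) →* H(𝐀ⁿ × 𝐀ⁿ, std)`** — Darboux coordinates followed by the coboundary
`((x, y), t) ↦ ((x, y), t + ½ x·y)` from the symplectic law `½ φ` to the polarised law `x · y'`
(`halfAltPolarEquiv ∘ Heisenberg.map e⁻¹`). [cite: GelbartRogawski1991, §3.1 p. 454 L17–22; MoeglinVignerasWaldspurger1987,
Chap. 2 I.1] -/
def toCoordHeisenberg :
    AdelicHeisenberg F E V Φ →* Weil1964.AdelicHeisenberg F (Fin n) (1 : Matrix (Fin n) (Fin n) (AdeleRing (𝓞 F) F)) :=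
  (halfAltPolarEquiv (adelicForm F (Fin n) (1 : Matrix (Fin n) (Fin n) (AdeleRing (𝓞 F) F)))).toMonoidHom.comp
    (Heisenberg.map _ e.symm.toLinearMap.toAddMonoidHom (AddMonoidHom.id (AdeleRing (𝓞 F) F)) (frame_map_compat e he))

/-- `toCoordHeisenberg` on the vector component: Darboux coordinates. [cite: GelbartRogawski1991, §3.1 p. 454 L17–22] -/
@[simp] theorem toCoordHeisenberg_v (h : AdelicHeisenberg F E V Φ) : (toCoordHeisenberg e he h).v = e.symm h.v := rfl

/-- `toCoordHeisenberg` on the central component: `t ↦ t + ½ x·y`. [cite: MoeglinVignerasWaldspurger1987, Chap. 2 I.1] -/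
@[simp] theorem toCoordHeisenberg_t (h : AdelicHeisenberg F E V Φ) :
    (toCoordHeisenberg e he h).t = h.t + ⅟(2 : AdeleRing (𝓞 F) F) *
      adelicForm F (Fin n) (1 : Matrix (Fin n) (Fin n) (AdeleRing (𝓞 F) F)) (e.symm h.v).1 (e.symm h.v).2 := rfl

/-- `toCoordHeisenberg` is the identity on the centre. [cite: MoeglinVignerasWaldspurger1987, Chap. 2 I.1] -/
theorem toCoordHeisenberg_ofCenter (t : AdeleRing (𝓞 F) F) :
    toCoordHeisenberg e he (Heisenberg.ofCenter (heisForm F E V Φ) (Multiplicative.ofAdd t)) =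
      Heisenberg.ofCenter _ (Multiplicative.ofAdd t) := by
  apply Heisenberg.ext
  · show e.symm 0 = 0
    exact map_zero _
  · show t + ⅟(2 : AdeleRing (𝓞 F) F) * adelicForm F (Fin n) (1 : Matrix (Fin n) (Fin n) (AdeleRing (𝓞 F) F))
        (e.symm 0).1 (e.symm 0).2 = t
    rw [map_zero, Prod.fst_zero, map_zero, LinearMap.zero_apply, mul_zero, add_zero]

/-- `toCoordHeisenberg` is onto. [cite: GelbartRogawski1991, §3.1 p. 454 L17–22] -/
theorem toCoordHeisenberg_surjective : Function.Surjective (toCoordHeisenberg e he) := fun g => by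
  refine ⟨⟨e g.v, g.t - ⅟(2 : AdeleRing (𝓞 F) F) *
    adelicForm F (Fin n) (1 : Matrix (Fin n) (Fin n) (AdeleRing (𝓞 F) F)) g.v.1 g.v.2⟩, ?_⟩
  apply Heisenberg.ext
  · exact e.symm_apply_apply g.v
  · show g.t - _ + ⅟(2 : AdeleRing (𝓞 F) F) * adelicForm F (Fin n) (1 : Matrix (Fin n) (Fin n) (AdeleRing (𝓞 F) F))
        (e.symm (e g.v)).1 (e.symm (e g.v)).2 = g.t
    rw [LinearEquiv.symm_apply_apply, sub_add_cancel]

/-- `toCoordHeisenberg` is injective. [cite: GelbartRogawski1991, §3.1 p. 454 L17–22] -/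
theorem toCoordHeisenberg_injective : Function.Injective (toCoordHeisenberg e he) := fun h h' hh => by
  have hv : h.v = h'.v := by
    have h1 := congrArg (fun g => e (Heisenberg.v g)) hh
    simpa only [toCoordHeisenberg_v, LinearEquiv.apply_symm_apply] using h1
  apply Heisenberg.ext hv
  have h2 := congrArg Heisenberg.t hh
  rw [toCoordHeisenberg_t, toCoordHeisenberg_t, hv] at h2
  exact add_right_cancel h2

include he in
/-- the Heisenberg law of `H_𝐀(W)` read in the frame: `heisForm v v' = (½ altPolar std) (e⁻¹ v) (e⁻¹ v')`.
[cite: GelbartRogawski1991, §3.1 p. 454 L17–19] -/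
theorem heisForm_eq_frame (v v' : AdelicSpace F V) :
    heisForm F E V Φ v v' =
      ((⅟(2 : AdeleRing (𝓞 F) F)) • altPolar (adelicForm F (Fin n) (1 : Matrix (Fin n) (Fin n) (AdeleRing (𝓞 F) F))))
        (e.symm v) (e.symm v') := by
  rw [← heisForm_frame e he, e.apply_symm_apply, e.apply_symm_apply]

include he in
/-- the conjugate `e g₁ e⁻¹` of a standard symplectic automorphism is in `Sp_𝐀(W)`.
[cite: GelbartRogawski1991, §3.1 p. 454 L17–22; Weil1964, Chap. I n° 5] -/
theorem frameConj_mem_adelicSp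
    (g : symplecticGroup (polar (adelicForm F (Fin n) (1 : Matrix (Fin n) (Fin n) (AdeleRing (𝓞 F) F))))) :
    (e.symm.trans (g : ((Fin n → AdeleRing (𝓞 F) F) × (Fin n → AdeleRing (𝓞 F) F)) ≃ₗ[AdeleRing (𝓞 F) F]
        ((Fin n → AdeleRing (𝓞 F) F) × (Fin n → AdeleRing (𝓞 F) F)))).trans e ∈ adelicSp F E V Φ := by
  rw [mem_symplecticGroup]
  intro w w'
  have hg := (mem_symplecticGroup _ _).1 g.2 (e.symm w) (e.symm w')
  simp only [LinearEquiv.trans_apply, heisForm_eq_frame e he, LinearEquiv.symm_apply_apply]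
  simp only [LinearMap.smul_apply, altPolar_apply, smul_eq_mul, polar_apply] at hg ⊢
  linear_combination (⅟(2 : AdeleRing (𝓞 F) F) + ⅟(2 : AdeleRing (𝓞 F) F)) * hg

/-- **`ofCoordSp e : Sp(𝐀ⁿ × 𝐀ⁿ, std) →* Sp_𝐀(W)`**, `g₁ ↦ e g₁ e⁻¹`. [cite: GelbartRogawski1991, §3.1 p. 454 L17–22;
Weil1964, Chap. I n° 5] -/
def ofCoordSp :
    symplecticGroup (polar (adelicForm F (Fin n) (1 : Matrix (Fin n) (Fin n) (AdeleRing (𝓞 F) F)))) →*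
      adelicSp F E V Φ where
  toFun g := ⟨(e.symm.trans (g : ((Fin n → AdeleRing (𝓞 F) F) × (Fin n → AdeleRing (𝓞 F) F)) ≃ₗ[AdeleRing (𝓞 F) F]
      ((Fin n → AdeleRing (𝓞 F) F) × (Fin n → AdeleRing (𝓞 F) F)))).trans e, frameConj_mem_adelicSp e he g⟩
  map_one' := Subtype.ext (LinearEquiv.ext fun w => by
    change e ((1 : ((Fin n → AdeleRing (𝓞 F) F) × (Fin n → AdeleRing (𝓞 F) F)) ≃ₗ[AdeleRing (𝓞 F) F]
      ((Fin n → AdeleRing (𝓞 F) F) × (Fin n → AdeleRing (𝓞 F) F))) (e.symm w)) = w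
    exact e.apply_symm_apply w)
  map_mul' g g' := Subtype.ext (LinearEquiv.ext fun w => by
    change e (((g : ((Fin n → AdeleRing (𝓞 F) F) × (Fin n → AdeleRing (𝓞 F) F)) ≃ₗ[AdeleRing (𝓞 F) F]
        ((Fin n → AdeleRing (𝓞 F) F) × (Fin n → AdeleRing (𝓞 F) F))) *
        (g' : ((Fin n → AdeleRing (𝓞 F) F) × (Fin n → AdeleRing (𝓞 F) F)) ≃ₗ[AdeleRing (𝓞 F) F]
          ((Fin n → AdeleRing (𝓞 F) F) × (Fin n → AdeleRing (𝓞 F) F)))) (e.symm w)) =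
      e ((g : ((Fin n → AdeleRing (𝓞 F) F) × (Fin n → AdeleRing (𝓞 F) F)) ≃ₗ[AdeleRing (𝓞 F) F]
        ((Fin n → AdeleRing (𝓞 F) F) × (Fin n → AdeleRing (𝓞 F) F))) (e.symm (e
          ((g' : ((Fin n → AdeleRing (𝓞 F) F) × (Fin n → AdeleRing (𝓞 F) F)) ≃ₗ[AdeleRing (𝓞 F) F]
            ((Fin n → AdeleRing (𝓞 F) F) × (Fin n → AdeleRing (𝓞 F) F))) (e.symm w)))))
    rw [LinearEquiv.mul_apply, LinearEquiv.symm_apply_apply])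

/-- `ofCoordSp e g₁` applied to `e c` is `e (g₁ c)`: the frame relation. [cite: GelbartRogawski1991, §3.1 p. 454 L17–22] -/
@[simp] theorem ofCoordSp_apply_frame
    (g : symplecticGroup (polar (adelicForm F (Fin n) (1 : Matrix (Fin n) (Fin n) (AdeleRing (𝓞 F) F)))))
    (c : (Fin n → AdeleRing (𝓞 F) F) × (Fin n → AdeleRing (𝓞 F) F)) :
    ((ofCoordSp e he g : adelicSp F E V Φ) : AdelicSpace F V ≃ₗ[AdeleRing (𝓞 F) F] AdelicSpace F V) (e c) =
      e ((g : ((Fin n → AdeleRing (𝓞 F) F) × (Fin n → AdeleRing (𝓞 F) F)) ≃ₗ[AdeleRing (𝓞 F) F]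
        ((Fin n → AdeleRing (𝓞 F) F) × (Fin n → AdeleRing (𝓞 F) F))) c) := by
  change e ((g : ((Fin n → AdeleRing (𝓞 F) F) × (Fin n → AdeleRing (𝓞 F) F)) ≃ₗ[AdeleRing (𝓞 F) F]
    ((Fin n → AdeleRing (𝓞 F) F) × (Fin n → AdeleRing (𝓞 F) F))) (e.symm (e c))) = _
  rw [LinearEquiv.symm_apply_apply]

/-- `ofCoordSp e g₁` applied to `w` is `e (g₁ (e⁻¹ w))`. [cite: GelbartRogawski1991, §3.1 p. 454 L17–22] -/
theorem ofCoordSp_apply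
    (g : symplecticGroup (polar (adelicForm F (Fin n) (1 : Matrix (Fin n) (Fin n) (AdeleRing (𝓞 F) F)))))
    (w : AdelicSpace F V) :
    ((ofCoordSp e he g : adelicSp F E V Φ) : AdelicSpace F V ≃ₗ[AdeleRing (𝓞 F) F] AdelicSpace F V) w =
      e ((g : ((Fin n → AdeleRing (𝓞 F) F) × (Fin n → AdeleRing (𝓞 F) F)) ≃ₗ[AdeleRing (𝓞 F) F]
        ((Fin n → AdeleRing (𝓞 F) F) × (Fin n → AdeleRing (𝓞 F) F))) (e.symm w)) := rfl

/-- **the frame intertwines Weil's actions**: `toCoordHeisenberg (g · h) = g₁ · toCoordHeisenberg h` for `g = e g₁ e⁻¹`, where `·` is the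
action `ofSymplectic` of the symplectic group on the Heisenberg group on each side (on `H_𝐀(W)`: `(w, t) ↦ (g w, t)`, the law
being alternating; on `H(𝐀ⁿ × 𝐀ⁿ, std)`: with Weil's correction `½(β(g₁c, g₁c) - β(c, c))`).
[cite: Weil1964, Chap. I n° 5 pp. 150–151; MoeglinVignerasWaldspurger1987, Chap. 2 I.1] -/
theorem toCoordHeisenberg_act
    (g : symplecticGroup (polar (adelicForm F (Fin n) (1 : Matrix (Fin n) (Fin n) (AdeleRing (𝓞 F) F)))))
    (h : AdelicHeisenberg F E V Φ) :
    toCoordHeisenberg e he ((ofSymplectic (heisForm F E V Φ) (ofCoordSp e he g)).act h) =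
      (ofSymplectic _ g).act (toCoordHeisenberg e he h) := by
  apply Heisenberg.ext
  · show e.symm (((ofCoordSp e he g : adelicSp F E V Φ) : AdelicSpace F V ≃ₗ[AdeleRing (𝓞 F) F] AdelicSpace F V) h.v) =
      (g : ((Fin n → AdeleRing (𝓞 F) F) × (Fin n → AdeleRing (𝓞 F) F)) ≃ₗ[AdeleRing (𝓞 F) F]
        ((Fin n → AdeleRing (𝓞 F) F) × (Fin n → AdeleRing (𝓞 F) F))) (e.symm h.v)
    rw [ofCoordSp_apply, LinearEquiv.symm_apply_apply]
  · rw [toCoordHeisenberg_t, Heisenberg.PseudoSymplectic.act_t, Heisenberg.PseudoSymplectic.act_t, Heisenberg.PseudoSymplectic.act_v,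
      ofSymplectic_f, ofSymplectic_f, ofSymplectic_σ, toCoordHeisenberg_t, toCoordHeisenberg_v, heisForm_self_eq_zero e he,
      heisForm_self_eq_zero e he, ofCoordSp_apply, LinearEquiv.symm_apply_apply]
    simp only [polar_apply, sub_self, mul_zero, add_zero]
    ring

end Frame

/-! ## §2. The bounded pairs of the coordinate model give print's `Mp_𝐀(W)` -/

section Leg

variable {F : Type} [Field F] [NumberField F]
variable {E : Type} [Field E] [Algebra F E]
variable {V : Type} [AddCommGroup V] [Module F V]
variable {Φ : V →ₗ[F] V →ₗ[F] E}
variable {n : ℕ}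
  (e : ((Fin n → AdeleRing (𝓞 F) F) × (Fin n → AdeleRing (𝓞 F) F)) ≃ₗ[AdeleRing (𝓞 F) F] AdelicSpace F V)
  (he : ∀ c c' : (Fin n → AdeleRing (𝓞 F) F) × (Fin n → AdeleRing (𝓞 F) F),
    adelicTraceForm F E V Φ (e c) (e c') = c.1 ⬝ᵥ c'.2 - c'.1 ⬝ᵥ c.2)
variable {S : Type} [NormedAddCommGroup S] [InnerProductSpace ℂ S]
variable (ρ : Representation ℂ (AdelicHeisenberg F E V Φ) S)
  (ρ₁ : Representation ℂ (Weil1964.AdelicHeisenberg F (Fin n) (1 : Matrix (Fin n) (Fin n) (AdeleRing (𝓞 F) F))) S)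
  (hρ : ∀ (h : AdelicHeisenberg F E V Φ) (f : S), ρ h f = ρ₁ (toCoordHeisenberg e he h) f)
variable {G : Type*} [Group G]
  (ψ : G →* MpPsi ρ₁) (hψb : ∀ g : G, Continuous (MpPsi.toOp ρ₁ (ψ g)) ∧ Continuous (MpPsi.toOp ρ₁ (ψ g)).symm)

include hρ in
/-- **a bounded pair of the coordinate model, read through the frame, is a pair of print's `Mp_𝐀(W)`**: if
`(g₁, M) ∈ MpPsi ρ₁` with `M`, `M⁻¹` continuous, then `(e g₁ e⁻¹, M) ∈ Mp_𝐀(W)` for `ρ = ρ₁ ∘ toCoordHeisenberg e` — relation (A)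
transported by `toCoordHeisenberg_act`. [cite: GelbartRogawski1991, §3.1 p. 454 L21–24; MoeglinVignerasWaldspurger1987, Chap. 2
II.1 (A)] -/
theorem frame_mem_adelicMp
    (q : symplecticGroup (polar (adelicForm F (Fin n) (1 : Matrix (Fin n) (Fin n) (AdeleRing (𝓞 F) F)))) × (S ≃ₗ[ℂ] S))
    (hq : q ∈ MpPsi ρ₁) (hc : Continuous q.2) (hc' : Continuous q.2.symm) :
    ((ofCoordSp e he q.1, q.2) : adelicSp F E V Φ × (S ≃ₗ[ℂ] S)) ∈ adelicMp F E V Φ ρ := by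
  refine Subgroup.mem_inf.2 ⟨(mem_MpPsi ρ _).2 fun h f => ?_, ⟨hc, hc'⟩⟩
  show q.2 (ρ h f) = ρ ((ofSymplectic (heisForm F E V Φ) (ofCoordSp e he q.1)).act h) (q.2 f)
  rw [hρ, hρ, toCoordHeisenberg_act e he, (mem_MpPsi ρ₁ q).1 hq]

/-- the leg with values in the ambient product `Sp_𝐀(W) × GL(S)`: `g ↦ (e π(ψ g) e⁻¹, M_{ψ g})`.
[cite: GelbartRogawski1991, §3.1 p. 454 L21–25] -/
def legOfFrameProd : G →* adelicSp F E V Φ × (S ≃ₗ[ℂ] S) :=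
  ((ofCoordSp e he).comp ((MpPsi.proj ρ₁).comp ψ)).prod ((MpPsi.toOp ρ₁).comp ψ)

/-- the value of `legOfFrameProd`. [cite: GelbartRogawski1991, §3.1 p. 454 L21–25] -/
theorem legOfFrameProd_apply (g : G) :
    legOfFrameProd e he ρ₁ ψ g = (ofCoordSp e he (MpPsi.proj ρ₁ (ψ g)), MpPsi.toOp ρ₁ (ψ g)) := rfl

include hρ hψb in
/-- every value of `legOfFrameProd` is a pair of print's `Mp_𝐀(W)`. [cite: GelbartRogawski1991, §3.1 p. 454 L21–24] -/
theorem legOfFrameProd_mem (g : G) : legOfFrameProd e he ρ₁ ψ g ∈ adelicMp F E V Φ ρ :=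
  frame_mem_adelicMp e he ρ ρ₁ hρ _ (ψ g).2 (hψb g).1 (hψb g).2

/-- **`legOfFrame` — print's `Mp_𝐀(W)` receives the bounded pairs of the coordinate model**: for `ρ(h) = ρ₁(toCoordHeisenberg e h)`
and `ψ : G →* MpPsi ρ₁` with bounded operators, `g ↦ (e π(ψ g) e⁻¹, M_{ψ g}) : G →* Mp_𝐀(W)`.
[cite: GelbartRogawski1991, §3.1 p. 454 L21–27; Weil1964, Chap. III n° 37–39] -/
def legOfFrame : G →* adelicMp F E V Φ ρ :=
  (legOfFrameProd e he ρ₁ ψ).codRestrict (adelicMp F E V Φ ρ) (legOfFrameProd_mem e he ρ ρ₁ hρ ψ hψb)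

/-- the underlying pair of `legOfFrame g`. [cite: GelbartRogawski1991, §3.1 p. 454 L21–25] -/
theorem coe_legOfFrame (g : G) :
    ((legOfFrame e he ρ ρ₁ hρ ψ hψb g : adelicMp F E V Φ ρ) : adelicSp F E V Φ × (S ≃ₗ[ℂ] S)) =
      (ofCoordSp e he (MpPsi.proj ρ₁ (ψ g)), MpPsi.toOp ρ₁ (ψ g)) := rfl

/-- `π(legOfFrame g) = e π(ψ g) e⁻¹`. [cite: GelbartRogawski1991, §3.1 p. 454 L25] -/
theorem proj_legOfFrame (g : G) :
    proj F E V Φ ρ (legOfFrame e he ρ ρ₁ hρ ψ hψb g) = ofCoordSp e he (MpPsi.proj ρ₁ (ψ g)) := rfl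

/-- **the operator of `legOfFrame g` is the operator of `ψ g`** (the frame moves only the symplectic component).
[cite: GelbartRogawski1991, §3.1 p. 454 L24–25] -/
theorem op_legOfFrame (g : G) : op F E V Φ ρ (legOfFrame e he ρ ρ₁ hρ ψ hψb g) = MpPsi.toOp ρ₁ (ψ g) := rfl

/-- `π(legOfFrame g)` on `W_𝐀`: `w ↦ e (π(ψ g) (e⁻¹ w))`. [cite: GelbartRogawski1991, §3.1 p. 454 L25] -/
theorem projEnd_legOfFrame_apply (g : G) (w : AdelicSpace F V) :
    projEnd F E V Φ ρ (legOfFrame e he ρ ρ₁ hρ ψ hψb g) w =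
      e (((MpPsi.proj ρ₁ (ψ g) : symplecticGroup (polar (adelicForm F (Fin n)
          (1 : Matrix (Fin n) (Fin n) (AdeleRing (𝓞 F) F))))) :
        ((Fin n → AdeleRing (𝓞 F) F) × (Fin n → AdeleRing (𝓞 F) F)) ≃ₗ[AdeleRing (𝓞 F) F]
          ((Fin n → AdeleRing (𝓞 F) F) × (Fin n → AdeleRing (𝓞 F) F))) (e.symm w)) := rfl

/-- **over `Mp_ψ(𝐀ⁿ × 𝐀ⁿ, std)ᶜᵒⁿᵗ` and `ψ` over the identity, `legOfFrame` lies over the frame**: `π(legOfFrame m) (e c) =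
e (π₁(m) c)` — the relation of `DarbouxLegs`. [cite: GelbartRogawski1991, §3.1 p. 454 L21–30] -/
theorem proj_legOfFrame_frame
    (ψ : adelicMpCont F (Fin n) (1 : Matrix (Fin n) (Fin n) (AdeleRing (𝓞 F) F)) →* MpPsi ρ₁)
    (hψb : ∀ m, Continuous (MpPsi.toOp ρ₁ (ψ m)) ∧ Continuous (MpPsi.toOp ρ₁ (ψ m)).symm)
    (hψ : ∀ m, MpPsi.proj ρ₁ (ψ m) = adelicMpCont.proj F (Fin n) (1 : Matrix (Fin n) (Fin n) (AdeleRing (𝓞 F) F)) m)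
    (m : adelicMpCont F (Fin n) (1 : Matrix (Fin n) (Fin n) (AdeleRing (𝓞 F) F)))
    (c : (Fin n → AdeleRing (𝓞 F) F) × (Fin n → AdeleRing (𝓞 F) F)) :
    ((proj F E V Φ ρ (legOfFrame e he ρ ρ₁ hρ ψ hψb m) : adelicSp F E V Φ) :
        AdelicSpace F V ≃ₗ[AdeleRing (𝓞 F) F] AdelicSpace F V) (e c) =
      e (((adelicMpCont.proj F (Fin n) (1 : Matrix (Fin n) (Fin n) (AdeleRing (𝓞 F) F)) m :
            symplecticGroup (polar (adelicForm F (Fin n) (1 : Matrix (Fin n) (Fin n) (AdeleRing (𝓞 F) F))))) :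
          ((Fin n → AdeleRing (𝓞 F) F) × (Fin n → AdeleRing (𝓞 F) F)) ≃ₗ[AdeleRing (𝓞 F) F]
            ((Fin n → AdeleRing (𝓞 F) F) × (Fin n → AdeleRing (𝓞 F) F))) c) := by
  -- `π(legOfFrame m) = e π(ψ m) e⁻¹` definitionally; no `rw` against the subgroup-valued terms (slow `whnf`)
  have h1 : ((proj F E V Φ ρ (legOfFrame e he ρ ρ₁ hρ ψ hψb m) : adelicSp F E V Φ) :
        AdelicSpace F V ≃ₗ[AdeleRing (𝓞 F) F] AdelicSpace F V) (e c) =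
      e (((MpPsi.proj ρ₁ (ψ m) : symplecticGroup (polar (adelicForm F (Fin n)
          (1 : Matrix (Fin n) (Fin n) (AdeleRing (𝓞 F) F))))) :
        ((Fin n → AdeleRing (𝓞 F) F) × (Fin n → AdeleRing (𝓞 F) F)) ≃ₗ[AdeleRing (𝓞 F) F]
          ((Fin n → AdeleRing (𝓞 F) F) × (Fin n → AdeleRing (𝓞 F) F))) c) :=
    ofCoordSp_apply_frame e he _ c
  exact h1.trans (congrArg (fun g : symplecticGroup (polar (adelicForm F (Fin n)
      (1 : Matrix (Fin n) (Fin n) (AdeleRing (𝓞 F) F)))) =>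
    e ((g : ((Fin n → AdeleRing (𝓞 F) F) × (Fin n → AdeleRing (𝓞 F) F)) ≃ₗ[AdeleRing (𝓞 F) F]
      ((Fin n → AdeleRing (𝓞 F) F) × (Fin n → AdeleRing (𝓞 F) F))) c)) (hψ m))

/-! ## §3. Continuity for print's topology (rendering R2) -/

/-- a map into `Mp_𝐀(W)` is continuous when all its coordinates `x ↦ π(q x) w` and `x ↦ M_{q x} f` are (the printed
topology R2 is the initial topology of these). [cite: GelbartRogawski1991, §3.1 p. 454 L24–36] -/
private theorem continuous_to_adelicMp_aux' {X : Type*} [TopologicalSpace X] {q : X → adelicMp F E V Φ ρ}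
    (h₁ : ∀ w : AdelicSpace F V, @Continuous X (AdelicSpace F V) _ (adelicSpaceTopology F V)
      fun x => projEnd F E V Φ ρ (q x) w)
    (h₂ : ∀ f : S, Continuous fun x => op F E V Φ ρ (q x) f) : Continuous q :=
  continuous_inf_rng.2 ⟨continuous_iInf_rng.2 fun w => continuous_induced_rng.2 (h₁ w),
    continuous_iInf_rng.2 fun f => continuous_induced_rng.2 (h₂ f)⟩

/-- **continuity of `legOfFrame` along a map** `t : Z → G`: if the symplectic orbit maps `z ↦ π(ψ(t z)) c` (adelic topology of
`𝐀ⁿ × 𝐀ⁿ`) and the operator orbit maps `z ↦ M_{ψ(t z)} f` are continuous, then `z ↦ legOfFrame (t z)` is continuous for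
print's topology on `Mp_𝐀(W)` (the Darboux frame `e` is a homeomorphism for the adelic topologies, rendering R8).
[cite: GelbartRogawski1991, §3.1 p. 454 L24–36; Prop. 3.1.1 p. 455 L1–2] -/
theorem continuous_legOfFrame_comp {Z : Type*} [TopologicalSpace Z] (t : Z → G)
    (h₁ : ∀ c : (Fin n → AdeleRing (𝓞 F) F) × (Fin n → AdeleRing (𝓞 F) F), Continuous fun z =>
      ((MpPsi.proj ρ₁ (ψ (t z)) : symplecticGroup (polar (adelicForm F (Fin n)
          (1 : Matrix (Fin n) (Fin n) (AdeleRing (𝓞 F) F))))) :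
        ((Fin n → AdeleRing (𝓞 F) F) × (Fin n → AdeleRing (𝓞 F) F)) ≃ₗ[AdeleRing (𝓞 F) F]
          ((Fin n → AdeleRing (𝓞 F) F) × (Fin n → AdeleRing (𝓞 F) F))) c)
    (h₂ : ∀ f : S, Continuous fun z => MpPsi.toOp ρ₁ (ψ (t z)) f) :
    Continuous fun z => legOfFrame e he ρ ρ₁ hρ ψ hψb (t z) := by
  refine continuous_to_adelicMp_aux' ρ (fun w => ?_) (fun f => h₂ f)
  have hc : (fun z => projEnd F E V Φ ρ (legOfFrame e he ρ ρ₁ hρ ψ hψb (t z)) w) = fun z =>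
      e (((MpPsi.proj ρ₁ (ψ (t z)) : symplecticGroup (polar (adelicForm F (Fin n)
          (1 : Matrix (Fin n) (Fin n) (AdeleRing (𝓞 F) F))))) :
        ((Fin n → AdeleRing (𝓞 F) F) × (Fin n → AdeleRing (𝓞 F) F)) ≃ₗ[AdeleRing (𝓞 F) F]
          ((Fin n → AdeleRing (𝓞 F) F) × (Fin n → AdeleRing (𝓞 F) F))) (e.symm w)) := rfl
  rw [hc]
  exact @Continuous.comp Z _ (AdelicSpace F V) _ _ (adelicSpaceTopology F V) _ _ (continuous_coord (e := e))
    (h₁ (e.symm w))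

/-- **continuity of `legOfFrame` on `Mp_ψ(𝐀ⁿ × 𝐀ⁿ, std)ᶜᵒⁿᵗ` from the strong continuity of the operators**: over the smooth
metaplectic group of record (coefficient topology) with `ψ` over the identity, the symplectic orbit maps are continuous
for free (`adelicMpCont.continuous_proj_apply`), so `legOfFrame ψ` is continuous as soon as every `m ↦ M_{ψ m} f` is.
[cite: GelbartRogawski1991, §3.1 p. 454 L24–36; Prop. 3.1.1 p. 455 L1–2] -/
theorem continuous_legOfFrame_of_continuous_op
    (ψ : adelicMpCont F (Fin n) (1 : Matrix (Fin n) (Fin n) (AdeleRing (𝓞 F) F)) →* MpPsi ρ₁)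
    (hψb : ∀ m, Continuous (MpPsi.toOp ρ₁ (ψ m)) ∧ Continuous (MpPsi.toOp ρ₁ (ψ m)).symm)
    (hψ : ∀ m, MpPsi.proj ρ₁ (ψ m) = adelicMpCont.proj F (Fin n) (1 : Matrix (Fin n) (Fin n) (AdeleRing (𝓞 F) F)) m)
    (h₂ : ∀ f : S, Continuous fun m => MpPsi.toOp ρ₁ (ψ m) f) :
    Continuous (legOfFrame e he ρ ρ₁ hρ ψ hψb) := by
  refine continuous_legOfFrame_comp e he ρ ρ₁ hρ ψ hψb id (fun c => ?_) (fun f => h₂ f)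
  simp only [id, hψ]
  exact adelicMpCont.continuous_proj_apply c

end Leg

/-! ## §4. `DarbouxLegs` and the CM capstone from a bounded leg of the coordinate model -/

section Darboux

variable (F : Type) [Field F] [NumberField F]
variable (E : Type) [Field E] [Algebra F E]
variable (V : Type) [AddCommGroup V] [Module F V]
variable (Φ : V →ₗ[F] V →ₗ[F] E)
variable {S : Type} [NormedAddCommGroup S] [InnerProductSpace ℂ S]
variable (ρ : Representation ℂ (AdelicHeisenberg F E V Φ) S)

/-- **`DarbouxLegs` from ONE bounded, strongly continuous leg of the coordinate model over ONE Darboux frame.**  `e` an adelic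
Darboux frame, `ρ(h) = ρ₁(toCoordHeisenberg e h)` on the Hilbert space `S`, `ψ : Mp_ψ(𝐀ⁿ × 𝐀ⁿ, std)ᶜᵒⁿᵗ →* MpPsi ρ₁` over the identity
with bounded operators and continuous orbit maps `m ↦ M_{ψ m} f`: then `DarbouxLegs F E V Φ ρ n`
(`legOfFrame` + `darbouxLegs_of_darbouxLeg`). [cite: GelbartRogawski1991, §3.1 p. 454 L17–36; Weil1964, Chap. III n° 37–39] -/
theorem darbouxLegs_of_boundedLeg (n : ℕ)
    (e : ((Fin n → AdeleRing (𝓞 F) F) × (Fin n → AdeleRing (𝓞 F) F)) ≃ₗ[AdeleRing (𝓞 F) F] AdelicSpace F V)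
    (he : ∀ c c' : (Fin n → AdeleRing (𝓞 F) F) × (Fin n → AdeleRing (𝓞 F) F),
      adelicTraceForm F E V Φ (e c) (e c') = c.1 ⬝ᵥ c'.2 - c'.1 ⬝ᵥ c.2)
    (ρ₁ : Representation ℂ (Weil1964.AdelicHeisenberg F (Fin n) (1 : Matrix (Fin n) (Fin n) (AdeleRing (𝓞 F) F))) S)
    (hρ : ∀ (h : AdelicHeisenberg F E V Φ) (f : S), ρ h f = ρ₁ (toCoordHeisenberg e he h) f)
    (ψ : adelicMpCont F (Fin n) (1 : Matrix (Fin n) (Fin n) (AdeleRing (𝓞 F) F)) →* MpPsi ρ₁)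
    (hψb : ∀ m, Continuous (MpPsi.toOp ρ₁ (ψ m)) ∧ Continuous (MpPsi.toOp ρ₁ (ψ m)).symm)
    (hψ : ∀ m, MpPsi.proj ρ₁ (ψ m) = adelicMpCont.proj F (Fin n) (1 : Matrix (Fin n) (Fin n) (AdeleRing (𝓞 F) F)) m)
    (h₂ : ∀ f : S, Continuous fun m => MpPsi.toOp ρ₁ (ψ m) f) :
    DarbouxLegs F E V Φ ρ n :=
  darbouxLegs_of_darbouxLeg F E V Φ ρ n e he (legOfFrame e he ρ ρ₁ hρ ψ hψb)
    (continuous_legOfFrame_of_continuous_op e he ρ ρ₁ hρ ψ hψb hψ h₂)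
    (proj_legOfFrame_frame e he ρ ρ₁ hρ ψ hψb hψ)

end Darboux

section CM

variable (L : Type) [Field L] [NumberField L] [IsCMField L]
variable {n : ℕ}
-- `V` an `L`-space; its `L⁺`-structure is Mathlib's restriction (no separate binder).
variable (V : Type) [AddCommGroup V] [Module L V] [FiniteDimensional L V]
variable (Φ : V →ₗ[↥(maximalRealSubfield L)] V →ₗ[↥(maximalRealSubfield L)] L)
variable {S : Type} [NormedAddCommGroup S] [InnerProductSpace ℂ S] [CompleteSpace S]
variable (ρ : Representation ℂ (AdelicHeisenberg (↥(maximalRealSubfield L)) L V Φ) S)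

/-- **[We] + [GelbartRogawski1991, Prop. 3.1.1] AS PRINTED AT CM DATA from ONE bounded, strongly continuous leg of the
coordinate model.**  `L` a CM field, `F = L⁺`, `E = L`, `σ` = complex conjugation; binders of `Prop311AsPrinted` at these
parameters (`(V, Φ)` skew-Hermitian of `E`-dimension `n`, `φ = Tr Φ` non-degenerate, `ρ` isometric and irreducible); `e` an
adelic Darboux frame of `φ_𝐀` through which `ρ` is read off a representation `ρ₁` of `H(𝐀ⁿ × 𝐀ⁿ, std)`; `ψ : Mp_ψ(𝐀ⁿ × 𝐀ⁿ,
std)ᶜᵒⁿᵗ →* MpPsi ρ₁` over the identity with bounded operators and continuous orbit maps.  Then (a) `π` has exactly one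
rational splitting, and (b) for every rational splitting `i` the conclusion (1) ∧ (2) of Prop. 3.1.1 holds verbatim as rendered
in `Prop311AsPrinted` (`darbouxLegs_of_boundedLeg` + `prop311_CM_of_darbouxLeg`). [cite: GelbartRogawski1991, §3.1 p. 454
L17–42; Prop. 3.1.1 p. 455 L1–2; Weil1964, Chap. III n° 37–40] -/
theorem prop311_CM_of_boundedLeg (hn : Module.finrank L V = n)
    (hΦ₁ : ∀ (a : L) (x y : V), Φ (a • x) y = a * Φ x y)
    (hΦ₂ : ∀ (a : L) (x y : V), Φ x (a • y) = Φ x y * IsCMField.complexConj L a)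
    (hΦ₃ : ∀ x y : V, Φ y x = -IsCMField.complexConj L (Φ x y))
    (hφ : (traceForm (↥(maximalRealSubfield L)) L V Φ).Nondegenerate)
    (hρu : ∀ (h : AdelicHeisenberg (↥(maximalRealSubfield L)) L V Φ) (v : S), ‖ρ h v‖ = ‖v‖)
    (hρi : ∀ K : Submodule ℂ S, IsClosed (K : Set S) →
      (∀ (h : AdelicHeisenberg (↥(maximalRealSubfield L)) L V Φ), ∀ v ∈ K, ρ h v ∈ K) → K = ⊥ ∨ K = ⊤)
    (e : ((Fin n → AdeleRing (𝓞 ↥(maximalRealSubfield L)) ↥(maximalRealSubfield L)) ×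
        (Fin n → AdeleRing (𝓞 ↥(maximalRealSubfield L)) ↥(maximalRealSubfield L))) ≃ₗ[
          AdeleRing (𝓞 ↥(maximalRealSubfield L)) ↥(maximalRealSubfield L)] AdelicSpace (↥(maximalRealSubfield L)) V)
    (he : ∀ c c' : (Fin n → AdeleRing (𝓞 ↥(maximalRealSubfield L)) ↥(maximalRealSubfield L)) ×
        (Fin n → AdeleRing (𝓞 ↥(maximalRealSubfield L)) ↥(maximalRealSubfield L)),
      adelicTraceForm (↥(maximalRealSubfield L)) L V Φ (e c) (e c') = c.1 ⬝ᵥ c'.2 - c'.1 ⬝ᵥ c.2)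
    (ρ₁ : Representation ℂ (Weil1964.AdelicHeisenberg (↥(maximalRealSubfield L)) (Fin n)
      (1 : Matrix (Fin n) (Fin n) (AdeleRing (𝓞 ↥(maximalRealSubfield L)) ↥(maximalRealSubfield L)))) S)
    (hρ : ∀ (h : AdelicHeisenberg (↥(maximalRealSubfield L)) L V Φ) (f : S), ρ h f = ρ₁ (toCoordHeisenberg e he h) f)
    (ψ : adelicMpCont (↥(maximalRealSubfield L)) (Fin n)
        (1 : Matrix (Fin n) (Fin n) (AdeleRing (𝓞 ↥(maximalRealSubfield L)) ↥(maximalRealSubfield L))) →* MpPsi ρ₁)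
    (hψb : ∀ m, Continuous (MpPsi.toOp ρ₁ (ψ m)) ∧ Continuous (MpPsi.toOp ρ₁ (ψ m)).symm)
    (hψ : ∀ m, MpPsi.proj ρ₁ (ψ m) = adelicMpCont.proj (↥(maximalRealSubfield L)) (Fin n)
      (1 : Matrix (Fin n) (Fin n) (AdeleRing (𝓞 ↥(maximalRealSubfield L)) ↥(maximalRealSubfield L))) m)
    (h₂ : ∀ f : S, Continuous fun m => MpPsi.toOp ρ₁ (ψ m) f) :
    (∃! i : ratSp (↥(maximalRealSubfield L)) L V Φ →* adelicMp (↥(maximalRealSubfield L)) L V Φ ρ,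
        IsRationalSplitting (↥(maximalRealSubfield L)) L V Φ ρ i) ∧
      ∀ i : ratSp (↥(maximalRealSubfield L)) L V Φ →* adelicMp (↥(maximalRealSubfield L)) L V Φ ρ,
        IsRationalSplitting (↥(maximalRealSubfield L)) L V Φ ρ i →
          ((∃ s : adelicUnitary (↥(maximalRealSubfield L)) L V Φ →* adelicMp (↥(maximalRealSubfield L)) L V Φ ρ,
              ∀ g : adelicUnitary (↥(maximalRealSubfield L)) L V Φ,
                projEnd (↥(maximalRealSubfield L)) L V Φ ρ (s g) =
                  ((g : AdelicSpace (↥(maximalRealSubfield L)) V ≃ₗ[AdeleRing (𝓞 ↥(maximalRealSubfield L)) ↥(maximalRealSubfield L)]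
                      AdelicSpace (↥(maximalRealSubfield L)) V) :
                    AdelicSpace (↥(maximalRealSubfield L)) V →ₗ[AdeleRing (𝓞 ↥(maximalRealSubfield L)) ↥(maximalRealSubfield L)]
                      AdelicSpace (↥(maximalRealSubfield L)) V)) ∧
            ∃ s : adelicUnitary (↥(maximalRealSubfield L)) L V Φ →* adelicMp (↥(maximalRealSubfield L)) L V Φ ρ,
              Continuous s ∧
              (∀ g : adelicUnitary (↥(maximalRealSubfield L)) L V Φ,
                projEnd (↥(maximalRealSubfield L)) L V Φ ρ (s g) =
                  ((g : AdelicSpace (↥(maximalRealSubfield L)) V ≃ₗ[AdeleRing (𝓞 ↥(maximalRealSubfield L)) ↥(maximalRealSubfield L)]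
                      AdelicSpace (↥(maximalRealSubfield L)) V) :
                    AdelicSpace (↥(maximalRealSubfield L)) V →ₗ[AdeleRing (𝓞 ↥(maximalRealSubfield L)) ↥(maximalRealSubfield L)]
                      AdelicSpace (↥(maximalRealSubfield L)) V)) ∧
              ∀ g : adelicUnitary (↥(maximalRealSubfield L)) L V Φ,
                IsRationalPoint (↥(maximalRealSubfield L)) L V Φ
                    (g : AdelicSpace (↥(maximalRealSubfield L)) V ≃ₗ[AdeleRing (𝓞 ↥(maximalRealSubfield L)) ↥(maximalRealSubfield L)]
                      AdelicSpace (↥(maximalRealSubfield L)) V) →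
                  s g ∈ i.range) :=
  prop311_CM_of_darbouxLeg L V Φ ρ hn hΦ₁ hΦ₂ hΦ₃ hφ hρu hρi e he (legOfFrame e he ρ ρ₁ hρ ψ hψb)
    (continuous_legOfFrame_of_continuous_op e he ρ ρ₁ hρ ψ hψb hψ h₂)
    (proj_legOfFrame_frame e he ρ ρ₁ hρ ψ hψb hψ)

end CM

end Prop311

end Literature.NumberTheory.GelbartRogawski1991

end
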